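import Summits.BirchSwinnertonDyer.BirchSwinnertonDyer.Theorems.TwoAdicConverseBDPTrivialCharSplitLineFiniteImprimitive
import Summits.BirchSwinnertonDyer.BirchSwinnertonDyer.Theorems.TwoAdicConverseBDPSelmerLowerDivisibilityAtTwoSplitPrimePairExists
import Summits.BirchSwinnertonDyer.BirchSwinnertonDyer.Theorems.EisensteinPrimesCharResidualSelmerFinite
import Literature.NumberTheory.IwasawaTheory.SplitPrimeIwasawaModuleTorsion
import Literature.NumberTheory.IwasawaTheory.SplitPrimeIwasawaModuleMuZero
import Literature.NumberTheory.IwasawaTheory.SplitPrimeIwasawaModuleTrivialOfClassNumber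
import Literature.NumberTheory.EllipticCurves.DeShalit1987.SplitPrimeTowerFinitelyDecomposed
import Literature.NumberTheory.GaloisRepresentations.TameInertiaTorsionHomsFiniteProofs
import Literature.NumberTheory.EllipticCurves.KellerYin2024.CharacterModulePrufer
import Literature.NumberTheory.EllipticCurves.ZpExtensionUnramifiedProofs
import HarnessLib

/-!
# P4 `TrivialCharSplitLineFiniteAt` FROM PRINT: Oukhaba–Viguié 2016 Thm. 1.2 + Greenberg 1978 §4 + de Shalit 1987
# II.1.9 (iii) ⟹ over every `ℤ₂`-line of an imaginary quadratic `K` ramified only at the split prime `v`, the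
# `S₀`-imprimitive BDP-type Selmer set of the TRIVIAL character `ℚ₂/ℤ₂` has finite `2`-torsion (crux O2
# `BDPSelmerLowerDivisibilityAtTwo`, stmt-BirchSwinnertonDyer-24728; v7 stub `stub_trivialCharSplitLineFinite`)

Helper file `--supports stmt-BirchSwinnertonDyer-24728` (seat `bsd-2adic-t42` GEN 36, pen SUMMON «P4-PRINT OV16 1.2 + Gr78 +
CKL19 1.1», director-bsd (556)(C)(iii)). THEOREMS ONLY: no definition, no named fact, no instance, no `sorry`. CONDITIONAL on
three cited named facts taken BY NAME as hypotheses (typed ≠ proved; each is a published theorem, none is the stub reworded):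
(F2) `Greenberg1978.splitPrime_iwasawaModule_finite_torsion` (X_∞ f.g. `Λ`-torsion), (F1)
`OukhabaViguie2016.thm12_splitPrime_muInvariant_eq_zero` (`μ(X_∞) = 0`, all `p`), (DEC)
`DeShalit1987.propII19iii_splitPrimeLine_finitelyDecomposed` (every `𝔮 ≠ v` finitely decomposed in `K_∞^{(v)}`). Nothing
about any elliptic curve is asserted; O2 / 19556 / 19218 stay OPEN; BSD is proved for no curve.

## The chain (every other step is KERNEL)

1. `RamifiedOnlyIn κ {v}` (all primes of `K̄`) ⟹ Agboola's `κ.IsUnramifiedOutside v` (conv-1 GEN 39,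
   `TwoAdicBDPSplitPrimePair.isUnramifiedOutside_of_inertiaOutside_singleton_subset`).
2. (F2) + (F1) at the canonical dual datum `KellerYin2024.unrDualData` of `H¹_{nr outside v}(K_∞, ℚ_p/ℤ_p)` ⟹ `X_∞` is f.g.
   over `ℤ_p` (Washington §13.2) ⟹ `S^{∅}[p]` finite (Pontryagin, tree `CharResidualSelmerFinite.finite_pTorsion_of_muInvariant_eq_zero`)
   — `finite_pTorsion_unrSelmer_empty_of_printFacts`, ANY `p`.
3. `∅ ⇝ S₀` (tree `TwoAdicBDPTrivialCharLine.finite_pTorsion_datumSelmer_of_empty`, the Hom picture): the action on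
   `ℚ_p/ℤ_p(𝟙)` is trivial (`smul_trivialCharacterModule`); every `𝔮 ∈ S₀`, `𝔮 ∤ p`, is `≠ v`, hence finitely decomposed
   (DEC) and `I_𝔮 ≤ ker κ`; the continuous additive `p`-torsion maps on `I_{K_𝔮}` are finitely many (tame inertia is
   pro-cyclic, tree `finite_setOf_continuous_mulToAdd_torsion_absInertia`, with `(ℚ_p/ℤ_p)[p]` finite,
   `finite_pTorsion_trivialCharacterModule`) — `finite_pTorsion_unrSelmer_of_printFacts`, ANY `p`.
4. `p = 2` display **`trivialCharSplitLineFiniteAtTwo_of_printFacts`** = the v7 decl `TrivialCharSplitLineFiniteAtTwo` of the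
   line of record (`Cruxes/BDPSelmerLowerDivisibilityAtTwo/Lines/two_variable_gv_squeeze_two.lean`) UNFOLDED character for
   character (the `Cruxes` file is not importable): one-line discharge there,
   `stub_trivialCharSplitLineFinite := fun K _ _ ↦ trivialCharSplitLineFiniteAtTwo_of_printFacts hGr hOV hdec K`
   with the three print binders `hGr hOV hdec` added to the line's hypotheses (admissible named facts, like KatzSheet).
5. Sharpening on habitat (β)'s field (`h_K` odd, e.g. `ℚ(√−7)`): (F3) `ChoiKezukaLi2019.lemma51_…` (`X_∞ = 0`) gives
   `S^{∅} = 0` outright — `unrSelmer_empty_subsingleton_of_lemma51` (not needed for P4).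

References: [OukhabaViguie2016MuInvariant] Thm. 1.2; [Greenberg1978] §4; [ChoiKezukaLi2019] Lemma 5.1; [deShalit1987]
II.1.9 (iii), II.4.17; [Washington1997] §13.2; [SerreLocalFields1979] IV §2; [GreenbergVatsal2000] §2; [KellerYin2024] §1.2.
-/

-- D-0017: single-problem summit, the namespace repeats the problem name by design.
set_option linter.dupNamespace false
set_option autoImplicit false

noncomputable section

open scoped Classical

open NumberField IsDedekindDomain Field
open Literature.NumberTheory.GaloisRepresentations Literature.NumberTheory.EllipticCurves
  Literature.NumberTheory.EllipticCurves.GreenbergSelmer Literature.NumberTheory.EllipticCurves.GreenbergVatsal2000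
  Literature.NumberTheory.IwasawaTheory

namespace Summit.BirchSwinnertonDyer.BirchSwinnertonDyer.Theorems.TwoAdicBDPTrivialCharLine

/-! ## §1 The trivial character module `ℚ_p/ℤ_p(𝟙)` -/

section Module

variable {K : Type} [Field K] [NumberField K] {p : ℕ} [Fact p.Prime]

/-- The Galois action on `trivialCharacterModule K p = (F/𝒪)(𝟙)` is TRIVIAL (`θ = 1` acts by the identity matrix).
[cite: KellerYin2024, §1.1 (arXiv:2402.12781v2 TeX L441–449)] -/
theorem smul_trivialCharacterModule (σ : absoluteGaloisGroup K) (m : trivialCharacterModule K p) : σ • m = m := by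
  obtain ⟨x, rfl⟩ := GreenbergSelmer.cofreeMk_surjective _ _ m
  rw [GreenbergSelmer.smul_cofreeMk, GreenbergSelmer.fracRepresentation_apply_apply]
  congr 1
  have h1 : ((1 : FramedGaloisRep K (padicCoeffIntegers (∅ : Set (PadicAlgCl p))) 1) σ :
      GL (Fin 1) (padicCoeffIntegers (∅ : Set (PadicAlgCl p)))) = 1 := rfl
  rw [h1]
  simp

/-- `(ℚ_p/ℤ_p)(𝟙)[p]` is finite (`≅ ℤ/p`: through `KellerYin2024.charModuleEquiv : (F/𝒪)(θ) ≃+ ℚ_p/ℤ_p` every `p`-torsion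
element is a multiple of `p⁻¹`). [cite: KellerYin2024, §1.1 (arXiv:2402.12781v2 TeX L441–449)] -/
theorem finite_pTorsion_trivialCharacterModule (K : Type) [Field K] [NumberField K] (p : ℕ) [Fact p.Prime] :
    Set.Finite {m : trivialCharacterModule K p | p • m = 0} := by
  let e := KellerYin2024.charModuleEquiv (1 : FramedGaloisRep K (padicCoeffIntegers (∅ : Set (PadicAlgCl p))) 1)
  have hQ : Set.Finite {q : QpModZp p | p • q = 0} := by
    refine ((Finset.range p).finite_toSet.image fun m : ℕ ↦ m • QpModZp.tgen p 1).subset ?_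
    intro q hq
    obtain ⟨m, rfl⟩ := QpModZp.exists_eq_nsmul_tgen_one hq
    refine ⟨m % p, Finset.mem_coe.2 (Finset.mem_range.2 (Nat.mod_lt _ (Fact.out : p.Prime).pos)), ?_⟩
    change (m % p) • QpModZp.tgen p 1 = m • QpModZp.tgen p 1
    conv_rhs => rw [← Nat.mod_add_div m p, add_smul, show p * (m / p) = (m / p) * p from mul_comm _ _, mul_smul,
      QpModZp.p_nsmul_tgen_one, nsmul_zero, add_zero]
  refine (hQ.preimage e.injective.injOn).subset fun m hm ↦ ?_
  change p • e m = 0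
  rw [← map_nsmul, show p • m = 0 from hm, map_zero]

end Module

/-! ## §2 `S^{∅}[p]` finite from the print facts (any `p`) -/

section Empty

variable {K : Type} [Field K] [NumberField K] {p : ℕ} [Fact p.Prime]

/-- **(F2) + (F1) ⟹ `H¹_{nr outside v}(K_∞, ℚ_p/ℤ_p)[p]` finite** (any `p`): at the canonical dual datum `unrDualData`
(for any topological generator `γ`) the `Λ`-module is f.g. torsion with `μ = 0`, hence f.g. over `ℤ_p` (Washington
§13.2), and then the `p`-torsion of the Selmer set is finite (Pontryagin, tree
`CharResidualSelmerFinite.finite_pTorsion_of_muInvariant_eq_zero`). [cite: OukhabaViguie2016MuInvariant, Thm. 1.2]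
[cite: Greenberg1978, §4] [cite: Washington1997, §13.2] -/
theorem finite_pTorsion_unrSelmer_empty_of_printFacts
    (hGr : Greenberg1978.splitPrime_iwasawaModule_finite_torsion)
    (hOV : OukhabaViguie2016.thm12_splitPrime_muInvariant_eq_zero)
    (hK : IsImaginaryQuadratic K) {v vbar : HeightOneSpectrum (𝓞 K)} (hv : ((p : ℕ) : 𝓞 K) ∈ v.asIdeal)
    (hvbar : ((p : ℕ) : 𝓞 K) ∈ vbar.asIdeal) (hne : vbar ≠ v) {κ : ZpExtension K p} (hκ : κ.IsUnramifiedOutside v) :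
    Set.Finite {t : subgroupH1 κ.kerSubgroup (trivialCharacterModule K p) |
      t ∈ datumSelmerInfty κ (trivialCharacterModule K p)
        (Castella2018.AcSelmer.bdpData (trivialCharacterModule K p) p vbar) (∅ : Set (HeightOneSpectrum (𝓞 K))) ∧
      p • t = 0} := by
  obtain ⟨γ, hγ⟩ : ∃ γ : absoluteGaloisGroup K, κ.IsTopGenerator γ := κ.surjective (Multiplicative.ofAdd 1)
  let X : DatumDualData κ γ (trivialCharacterModule K p)
      (Castella2018.AcSelmer.bdpData (trivialCharacterModule K p) p vbar) (∅ : Set (HeightOneSpectrum (𝓞 K))) :=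
    KellerYin2024.unrDualData κ vbar ∅
      (exists_pow_smul_cofree_eq_zero (∅ : Set (PadicAlgCl p))
        (1 : FramedGaloisRep K (padicCoeffIntegers (∅ : Set (PadicAlgCl p))) 1))
      (isOpen_stabilizer_cofree (∅ : Set (PadicAlgCl p))
        (1 : FramedGaloisRep K (padicCoeffIntegers (∅ : Set (PadicAlgCl p))) 1)) hγ
  obtain ⟨hfg, htor⟩ := hGr K hK p v vbar hv hvbar hne κ hκ γ hγ X
  have hμ : muInvariant p X.X = 0 := hOV K hK p v vbar hv hvbar hne κ hκ γ hγ X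
  haveI := hfg
  have hfin := CharResidualSelmerFinite.finite_pTorsion_of_muInvariant_eq_zero X htor hμ
  refine (hfin.image fun s : datumSelmerInfty κ (trivialCharacterModule K p)
      (Castella2018.AcSelmer.bdpData (trivialCharacterModule K p) p vbar) (∅ : Set (HeightOneSpectrum (𝓞 K))) ↦
      (s : subgroupH1 κ.kerSubgroup (trivialCharacterModule K p))).subset ?_
  rintro t ⟨ht, hpt⟩
  exact ⟨⟨t, ht⟩, Subtype.ext (by rw [AddSubgroupClass.coe_nsmul]; exact hpt), rfl⟩

/-- **(F3) sharpening on habitat (β)'s field**: if moreover `p ∤ h_K` (e.g. `K = ℚ(√−7)`, `p = 2`), Choi–Kezuka–Li's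
Lemma 5.1 (`X_∞ = 0`) makes the whole primitive Selmer set `H¹_{nr outside v}(K_∞, ℚ_p/ℤ_p)` TRIVIAL (characters
separate points). [cite: ChoiKezukaLi2019, Lemma 5.1 (arXiv:1711.01697 p0012 L5–18)] -/
theorem unrSelmer_empty_subsingleton_of_lemma51
    (hCKL : ChoiKezukaLi2019.lemma51_splitPrime_iwasawaModule_subsingleton)
    (hK : IsImaginaryQuadratic K) (hh : ¬ p ∣ NumberField.classNumber K) {v vbar : HeightOneSpectrum (𝓞 K)}
    (hv : ((p : ℕ) : 𝓞 K) ∈ v.asIdeal) (hvbar : ((p : ℕ) : 𝓞 K) ∈ vbar.asIdeal) (hne : vbar ≠ v)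
    {κ : ZpExtension K p} (hκ : κ.IsUnramifiedOutside v) :
    Subsingleton (datumSelmerInfty κ (trivialCharacterModule K p)
      (Castella2018.AcSelmer.bdpData (trivialCharacterModule K p) p vbar) (∅ : Set (HeightOneSpectrum (𝓞 K)))) := by
  obtain ⟨γ, hγ⟩ : ∃ γ : absoluteGaloisGroup K, κ.IsTopGenerator γ := κ.surjective (Multiplicative.ofAdd 1)
  let X : DatumDualData κ γ (trivialCharacterModule K p)
      (Castella2018.AcSelmer.bdpData (trivialCharacterModule K p) p vbar) (∅ : Set (HeightOneSpectrum (𝓞 K))) :=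
    KellerYin2024.unrDualData κ vbar ∅
      (exists_pow_smul_cofree_eq_zero (∅ : Set (PadicAlgCl p))
        (1 : FramedGaloisRep K (padicCoeffIntegers (∅ : Set (PadicAlgCl p))) 1))
      (isOpen_stabilizer_cofree (∅ : Set (PadicAlgCl p))
        (1 : FramedGaloisRep K (padicCoeffIntegers (∅ : Set (PadicAlgCl p))) 1)) hγ
  haveI hX : Subsingleton X.X := hCKL K hK p hh v vbar hv hvbar hne κ hκ γ hγ X
  refine ⟨fun s s' ↦ ?_⟩
  by_contra hss'
  have hne' : s - s' ≠ 0 := sub_ne_zero.mpr hss'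
  obtain ⟨χ, hχ⟩ := CharacterModule.exists_character_apply_ne_zero_of_ne_zero hne'
  obtain ⟨x, hx⟩ := X.bijective.2 χ
  apply hχ
  rw [← hx, Subsingleton.elim x 0, map_zero]
  rfl

end Empty

/-! ## §3 P4 from print: any finite `S₀` -/

section Assembly

variable {K : Type} [Field K] [NumberField K] {p : ℕ} [Fact p.Prime]

/-- **(F2) + (F1) + (DEC) ⟹ `S^{S₀}[p]` finite for every finite `S₀`** (any `p`), along the `ℤ_p`-line unramified outside
the split prime `v`: the passage `∅ ⇝ S₀` is the tree's `finite_pTorsion_datumSelmer_of_empty` (Hom picture), fed by the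
trivial action, the finite decomposition of every `𝔮 ∈ S₀`, `𝔮 ∤ p` (so `𝔮 ≠ v`) in `K_∞^{(v)}` (DEC), `I_𝔮 ≤ ker κ`, and the
finiteness of continuous additive `p`-torsion maps on `I_{K_𝔮}` (tame inertia pro-cyclic).
[cite: OukhabaViguie2016MuInvariant, Thm. 1.2] [cite: Greenberg1978, §4] [cite: deShalit1987, II.1.9 (iii)]
[cite: SerreLocalFields1979, Ch. IV §2 Cor. 1 and Cor. 3 of Prop. 7] -/
theorem finite_pTorsion_unrSelmer_of_printFacts
    (hGr : Greenberg1978.splitPrime_iwasawaModule_finite_torsion)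
    (hOV : OukhabaViguie2016.thm12_splitPrime_muInvariant_eq_zero)
    (hdec : DeShalit1987.propII19iii_splitPrimeLine_finitelyDecomposed)
    (hK : IsImaginaryQuadratic K) {v vbar : HeightOneSpectrum (𝓞 K)} (hv : ((p : ℕ) : 𝓞 K) ∈ v.asIdeal)
    (hvbar : ((p : ℕ) : 𝓞 K) ∈ vbar.asIdeal) (hne : vbar ≠ v) {κ : ZpExtension K p} (hκ : κ.IsUnramifiedOutside v)
    {S₀ : Set (HeightOneSpectrum (𝓞 K))} (hS₀ : S₀.Finite) :
    Set.Finite {t : subgroupH1 κ.kerSubgroup (trivialCharacterModule K p) |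
      t ∈ datumSelmerInfty κ (trivialCharacterModule K p)
        (Castella2018.AcSelmer.bdpData (trivialCharacterModule K p) p vbar) S₀ ∧ p • t = 0} := by
  refine finite_pTorsion_datumSelmer_of_empty κ
    (Castella2018.AcSelmer.bdpData (trivialCharacterModule K p) p vbar) smul_trivialCharacterModule hS₀
    (fun 𝔮 _ hp𝔮 ↦ ?_) (fun 𝔮 _ hp𝔮 ↦ ?_) (finite_pTorsion_unrSelmer_empty_of_printFacts hGr hOV hK hv hvbar hne hκ)
  · -- `𝔮 ≠ v` (as `p ∈ v`, `p ∉ 𝔮`), hence finitely decomposed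
    exact hdec K hK p v vbar hv hvbar hne κ hκ 𝔮 (fun h ↦ hp𝔮 (h ▸ hv))
  · -- `I_𝔮 ≤ ker κ` and tame inertia at `𝔮 ∤ p`
    have hq : 𝔮 ≠ v := fun h ↦ hp𝔮 (h ▸ hv)
    refine finite_torsionMaps_inertiaIn_of_local κ.kerSubgroup 𝔮 (hκ 𝔮 hq) ?_
    exact finite_setOf_continuous_mulToAdd_torsion_absInertia (𝔮.adicCompletion K) (trivialCharacterModule K p)
      (fun h ↦ 𝔮.ringChar_residueField_adicCompletion_ne hp𝔮
        ((Nat.prime_dvd_prime_iff_eq ringChar_residueField_prime (Fact.out : p.Prime)).mp h))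
      (finite_pTorsion_trivialCharacterModule K p)

/-- **P4 `TrivialCharSplitLineFiniteAtTwo` OF THE v7 LINE OF RECORD, FROM PRINT** — the decl of
`Cruxes/BDPSelmerLowerDivisibilityAtTwo/Lines/two_variable_gv_squeeze_two.lean` (= `∀ K, TrivialCharSplitLineFiniteAt K` of
seat 2's `split_prime_line_finite_two.lean`) UNFOLDED character for character: for every number field `K` — content only
for `K` imaginary quadratic with `2 = v v̄` split — every `ℤ₂`-extension `κ` with `RamifiedOnlyIn κ {v}`, and every finite
`S₀`, the `S₀`-imprimitive BDP-type Selmer set (unramified at `v̄`, relaxed at `v`) of the trivial character module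
`KellerYin2024.charModule ∅ 1 = ℚ₂/ℤ₂` over `K̄^{ker κ} = K_∞^{(v)}` has finite `2`-torsion; GRANTED BY NAME (F2) Greenberg
1978 §4, (F1) Oukhaba–Viguié 2016 Thm. 1.2, (DEC) de Shalit 1987 II.1.9 (iii). One-line discharge in the line file:
`stub_trivialCharSplitLineFinite := fun K _ _ ↦ trivialCharSplitLineFiniteAtTwo_of_printFacts hGr hOV hdec K`.
[cite: OukhabaViguie2016MuInvariant, Thm. 1.2 (arXiv:1311.3565 p0002 L6)] [cite: Greenberg1978, §4]
[cite: deShalit1987, II.1.9 (iii)] -/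
theorem trivialCharSplitLineFiniteAtTwo_of_printFacts
    (hGr : Greenberg1978.splitPrime_iwasawaModule_finite_torsion)
    (hOV : OukhabaViguie2016.thm12_splitPrime_muInvariant_eq_zero)
    (hdec : DeShalit1987.propII19iii_splitPrimeLine_finitelyDecomposed)
    (K : Type) [Field K] [NumberField K] :
    IsImaginaryQuadratic K → ∀ (v vbar : HeightOneSpectrum (𝓞 K)) (κ : ZpExtension K 2)
      (S₀ : Set (HeightOneSpectrum (𝓞 K))), S₀.Finite →
      ((2 : ℕ) : 𝓞 K) ∈ v.asIdeal → ((2 : ℕ) : 𝓞 K) ∈ vbar.asIdeal → vbar ≠ v →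
      Literature.NumberTheory.FaltingsSerre.inertiaOutside K {v} ⊆
        ((κ.kerSubgroup : Subgroup (Field.absoluteGaloisGroup K)) : Set (Field.absoluteGaloisGroup K)) →
      Set.Finite {t : subgroupH1 κ.kerSubgroup
          (KellerYin2024.charModule (∅ : Set (PadicAlgCl 2))
            (1 : FramedGaloisRep K (padicCoeffIntegers (∅ : Set (PadicAlgCl 2))) 1)) |
        t ∈ datumSelmerInfty κ
            (KellerYin2024.charModule (∅ : Set (PadicAlgCl 2))
              (1 : FramedGaloisRep K (padicCoeffIntegers (∅ : Set (PadicAlgCl 2))) 1))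
            (Castella2018.AcSelmer.bdpData
              (KellerYin2024.charModule (∅ : Set (PadicAlgCl 2))
                (1 : FramedGaloisRep K (padicCoeffIntegers (∅ : Set (PadicAlgCl 2))) 1)) 2 vbar) S₀ ∧
          2 • t = 0} := by
  intro hK v vbar κ S₀ hS₀ hv hvbar hne hram
  exact finite_pTorsion_unrSelmer_of_printFacts hGr hOV hdec hK hv hvbar hne
    (TwoAdicBDPSplitPrimePair.isUnramifiedOutside_of_inertiaOutside_singleton_subset hram) hS₀

/-- The same at ANY prime `p` (the GL(1) leaf is prime-uniform; `p = 2` is the display above).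
[cite: OukhabaViguie2016MuInvariant, Thm. 1.2] [cite: Greenberg1978, §4] [cite: deShalit1987, II.1.9 (iii)] -/
theorem trivialCharSplitLineFiniteAt_anyPrime_of_printFacts
    (hGr : Greenberg1978.splitPrime_iwasawaModule_finite_torsion)
    (hOV : OukhabaViguie2016.thm12_splitPrime_muInvariant_eq_zero)
    (hdec : DeShalit1987.propII19iii_splitPrimeLine_finitelyDecomposed)
    (p : ℕ) [Fact p.Prime] (K : Type) [Field K] [NumberField K] :
    IsImaginaryQuadratic K → ∀ (v vbar : HeightOneSpectrum (𝓞 K)) (κ : ZpExtension K p)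
      (S₀ : Set (HeightOneSpectrum (𝓞 K))), S₀.Finite →
      ((p : ℕ) : 𝓞 K) ∈ v.asIdeal → ((p : ℕ) : 𝓞 K) ∈ vbar.asIdeal → vbar ≠ v →
      Literature.NumberTheory.FaltingsSerre.inertiaOutside K {v} ⊆
        ((κ.kerSubgroup : Subgroup (Field.absoluteGaloisGroup K)) : Set (Field.absoluteGaloisGroup K)) →
      Set.Finite {t : subgroupH1 κ.kerSubgroup (trivialCharacterModule K p) |
        t ∈ datumSelmerInfty κ (trivialCharacterModule K p)
            (Castella2018.AcSelmer.bdpData (trivialCharacterModule K p) p vbar) S₀ ∧ p • t = 0} := by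
  intro hK v vbar κ S₀ hS₀ hv hvbar hne hram
  exact finite_pTorsion_unrSelmer_of_printFacts hGr hOV hdec hK hv hvbar hne
    (TwoAdicBDPSplitPrimePair.isUnramifiedOutside_of_inertiaOutside_singleton_subset hram) hS₀

end Assembly

end Summit.BirchSwinnertonDyer.BirchSwinnertonDyer.Theorems.TwoAdicBDPTrivialCharLine

end
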